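import Literature.Computability.Complexity.MCSPStarFromPCPTheorem
import Literature.Computability.Complexity.ApproximationProofs
import HarnessLib

/-!
# P vs NP family: NP-hardness of `MCSP*` — the discharge

Topic `Computability/Complexity`. Discharge of the named fact `isRandNPHard_MCSPStar`
(`MCSPHardness.lean`; Hirahara, FOCS 2022, Thm. 1.2 = Thm. 8.5 of the full version ECCC TR22-119:
"`MCSP*` … are NP-hard under randomized polynomial-time many-one reductions") and of its corollary
`NP_subset_BPP_of_MCSPStar_mem_BPP` (same file), now that the PCP theorem `pcp_theorem_exact` is a
theorem of the tree (`pcp_theorem_exact_holds`, `ApproximationProofs.lean`).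

The whole route is proved in the tree (`MCSPStarFromPCPTheorem.lean` and its imports):
`NP --Karp--> gapCSP` (PCP theorem, Arora–Barak Thm. 11.5, by Dinur's gap amplification)
`--Karp--> gapCMMSA g 1 K` (hitting-set embedding of a PCP verifier, `PCPToCMMSAMachine.lean`)
`--Karp--> gapCMMSA 107520 1 sqrtLog` (Alekhnovich–Buss–Moran–Pitassi self-improvement by squaring,
`CMMSASquaringMachine.lean`, and padding, `CMMSAPad.lean`) `--randomized--> MCSP*` (Hirahara's
Lemma 8.3 / proof of Thm. 8.5 at a constant gap, `HiraharaSpecConst.lean`, `MCSPStarFromRedOut.lean`,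
machine `HiraharaMachine.redOut_codeFP`), composed by `IsRandNPHard.of_isNPHard_promise`
(`PromiseRandReductions.lean`). This file only applies `isRandNPHard_MCSPStar_of_pcp_theorem` and
`NP_subset_BPP_of_MCSPStar_mem_BPP_of_pcp_theorem` to `pcp_theorem_exact_holds`; it cannot live in
`MCSPHardness.lean` itself, which every file of the route imports.

## References

* S. Hirahara, *NP-hardness of learning programs and partial MCSP*, FOCS 2022, pp. 968–979; full
  version ECCC TR22-119: Thm. 1.2 (p. 5), Def. 8.4 and Thm. 8.5 with its proof (pp. 30–31),
  Lemma 8.3 (p. 26), Thm. 5.2 (p. 16) [Hirahara2022PartialMCSP].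
* S. Arora, B. Barak, *Computational Complexity: A Modern Approach*, CUP 2009, Thm. 11.5, §7.6
  [AroraBarakCC2009].
-/

namespace Literature.Computability.Complexity

/-- **Hirahara 2022, Thm. 1.2 / Thm. 8.5 (`MCSP*` case): `MCSP*` is NP-hard under randomized
polynomial-time many-one reductions** — discharge of the named fact `isRandNPHard_MCSPStar`, from the
PCP theorem (`pcp_theorem_exact_holds`) by `isRandNPHard_MCSPStar_of_pcp_theorem`.
[cite: Hirahara2022PartialMCSP, Thm. 1.2 (p. 5) and Thm. 8.5 with its proof (pp. 30–31)] -/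
theorem isRandNPHard_MCSPStar_holds : isRandNPHard_MCSPStar :=
  isRandNPHard_MCSPStar_of_pcp_theorem pcp_theorem_exact_holds

/-- **`MCSP* ∈ BPP ⇒ NP ⊆ BPP`** — discharge of the named fact `NP_subset_BPP_of_MCSPStar_mem_BPP`
(the corollary of Thm. 1.2 by the downward closure of `BPP` under randomized reductions in
Arora–Barak's normal form), from the PCP theorem by
`NP_subset_BPP_of_MCSPStar_mem_BPP_of_pcp_theorem`.
[cite: Hirahara2022PartialMCSP, Thm. 1.2 (p. 5) and the discussion on p. 6; AroraBarakCC2009, §7.6] -/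
theorem NP_subset_BPP_of_MCSPStar_mem_BPP_holds : NP_subset_BPP_of_MCSPStar_mem_BPP :=
  NP_subset_BPP_of_MCSPStar_mem_BPP_of_pcp_theorem pcp_theorem_exact_holds

/-- **`MCSP*` is NP-complete under randomized polynomial-time many-one reductions**
(`IsRandComplete NP MCSPStar`), unconditionally: `MCSP* ∈ NP` (`MetaComplexity.MCSPStar_mem_NP_holds`)
and `isRandNPHard_MCSPStar_holds`. [cite: Hirahara2022PartialMCSP, Thm. 8.5 and §1.2 ("it is easy to see that MCSP ∈ NP")] -/
theorem isRandComplete_NP_MCSPStar :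
    MetaComplexity.IsRandComplete Nondeterministic.NP MetaComplexity.MCSPStar :=
  isRandComplete_NP_MCSPStar_of_isRandNPHard isRandNPHard_MCSPStar_holds

end Literature.Computability.Complexity
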